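import Summits.BirchSwinnertonDyer.BirchSwinnertonDyer.Theorems.ResidualThetaTransportAtTwoThetaLayerLambdaCongruenceAtTwoOfSdBz
import Summits.BirchSwinnertonDyer.BirchSwinnertonDyer.Theorems.ResidualThetaTransportAtTwoThetaLayerLambdaCongruenceAtTwoCosocleOfSelfDual
import Summits.BirchSwinnertonDyer.BirchSwinnertonDyer.Theorems.ResidualThetaTransportAtTwoThetaLayerLambdaCongruenceAtTwoHeckeAdjointTranspose
import HarnessLib

/-!
# Crux `ThetaLayerLambdaCongruenceAtTwo` (stmt-BirchSwinnertonDyer-20688, route ResidualThetaTransportAtTwo), line `birth` v14 —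
# END OF THE SD KERNEL ROAD: the Hecke self-duality of `J₀(N)[ℓ]` (item 27800's fact `heckeSelfDual_torsionBy_J0`) is a THEOREM, and
# the crux Kan⁺ — together with its registered stub `hcosW` — is conditional on Buzzard 2000 Prop. 2.4 ALONE (lead prover
# bsd-wall-rtt-p3 g13; `--supports stmt-BirchSwinnertonDyer-20688 --as helper`; closes nothing by itself)

HONEST FRAMING. Three one-line compositions of landed theorems; no definition; BSD is not proved by any of this. The Hecke clause of the
intersection pairing (`ip_of_crossingPairing_flagSides`, w3 g11's assembly p661089 of the cell's bricks HA1–HA8: w2 g8's perfect crossing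
pairing and dual chains, w3 g11's flags / side formula / discrete Jordan lemma / dual and Manin sums, w4 g7's cocycles and flipped assembly,
the lead's convex re-expansion / Manin anchors / sweeps) made `periodHomology_exists_heckeSelfAdjoint_perfectPairing` (IP) a theorem; hence:
* `heckeSelfDual_torsionBy_J0_holds` — DISCHARGE of the Literature named fact `heckeSelfDual_torsionBy_J0` (Darmon–Diamond–Taylor §1.6–1.7:
  a perfect `𝕋`-balanced pairing on `J₀(N)[ℓ]` for every `N ≥ 1` and every prime `ℓ`, on the tree's model `J0 N`), by the tree's
  `heckeSelfDual_torsionBy_J0_of_perfectPairing`; item 27800 `HeckeSelfDualTorsionJ0Input` is this fact by name;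
* `cosocleW_of_bz` — the registered stub `stub_cosocleMultOne : hcosW` of skeleton v14 from Bz ALONE (`cosocleW_of_sdBz` with SD discharged);
* `thetaLayerLambdaCongruenceAtTwo_of_bz` — **Kan⁺ BY NAME from `buzzard2000_multiplicityOne_gamma0` ALONE** (`…_of_ipBz` with IP discharged):
  the crux's print dependence is now exactly ONE published theorem (Buzzard, *On level-lowering for mod 2 representations*, Prop. 2.4 —
  mod-`2` multiplicity one for `ρ̄` non-scalar on a decomposition group at `2`), typed as item 27798. Kan⁺ is NOT settled.

References: [DarmonDiamondTaylor1995] §1.6 Lemma 1.38, §1.7, §4.5 (p. 134); [Merel1995Homologie] §1.2–1.3, §2.1–2.3;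
[Buzzard2000LevelLoweringModTwo] Prop. 2.4; [Pollack2003] Prop. 6.18 (shape of Kan⁺).
-/

set_option autoImplicit false

noncomputable section

-- justification: the `Summit.BirchSwinnertonDyer.BirchSwinnertonDyer.…` path repeats a component (route-file convention)
set_option linter.dupNamespace false

open scoped MatrixGroups NumberField
open CongruenceSubgroup IsDedekindDomain Rat.HeightOneSpectrum
open Literature.NumberTheory.EllipticCurves.Rank1Residual Literature.NumberTheory.EllipticCurves.ModularForms
open Summit.BirchSwinnertonDyer.BirchSwinnertonDyer.Theses.ResidualThetaTransportAtTwo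

namespace Summit.BirchSwinnertonDyer.BirchSwinnertonDyer.Theorems.ThetaLayerLambdaCongruenceAtTwo

/-- **DISCHARGE of the named fact `heckeSelfDual_torsionBy_J0`** (Hecke self-duality of `J₀(N)[ℓ]`, all `N ≥ 1`, all primes `ℓ`; item 27800's
fact): from the now-proved Hecke-self-adjoint perfect pairing on `H₁(X₀(N); ℤ)` (`ip_of_crossingPairing_flagSides`) through
`heckeSelfDual_torsionBy_J0_of_perfectPairing`. [cite: DarmonDiamondTaylor1995, §1.6 Lemma 1.38 and §4.5 (p. 134)] [cite: Merel1995Homologie, §2.1–2.3] -/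
theorem heckeSelfDual_torsionBy_J0_holds : heckeSelfDual_torsionBy_J0 :=
  heckeSelfDual_torsionBy_J0_of_perfectPairing ip_of_crossingPairing_flagSides

/-- **The registered stub `hcosW` of skeleton v14 from Bz ALONE**: cosocle multiplicity one `dim_{𝕋/𝔪} Λ/𝔪Λ = 2` at the mod-`2` eigen-ideals of
good-supersingular-at-`2` curves at odd levels, from `buzzard2000_multiplicityOne_gamma0` and the PROVED self-duality. CONDITIONAL on Bz.
[cite: Buzzard2000LevelLoweringModTwo, Prop. 2.4] [cite: DarmonDiamondTaylor1995, §4.5 (p. 134)] -/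
theorem cosocleW_of_bz (hBz : buzzard2000_multiplicityOne_gamma0) :
    ∀ (W : WeierstrassCurve ℚ) [W.IsElliptic] [W.IsGloballyMinimal], GoodSS W 2 →
      ∀ (L : ℕ) [NeZero L], Odd L →
      (∀ v : HeightOneSpectrum (𝓞 ℚ), ¬ ((primesEquiv v : ℕ) ∣ 2 * L) → W.HasGoodReductionAt v) →
      ∀ (𝔪 : Ideal (HeckeRing0 L 2)), 𝔪.IsMaximal → (2 : HeckeRing0 L 2) ∈ 𝔪 → Nat.card (HeckeRing0 L 2 ⧸ 𝔪) = 2 →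
      (∀ (q : ℕ) (hq : q.Prime), ¬ q ∣ L → HeckeRing0.T L 2 q hq - (W.LFunction q : HeckeRing0 L 2) ∈ 𝔪) →
      Module.finrank (HeckeRing0 L 2 ⧸ 𝔪)
        (periodHomologyHecke L ⧸ (𝔪 • ⊤ : Submodule (HeckeRing0 L 2) (periodHomologyHecke L))) = 2 :=
  cosocleW_of_sdBz heckeSelfDual_torsionBy_J0_holds hBz

/-- **Kan⁺ `ThetaLayerLambdaCongruenceAtTwo` BY NAME from Buzzard 2000 Prop. 2.4 ALONE.** The SD half of PUB² is a theorem
(`ip_of_crossingPairing_flagSides` ⟹ IP), so `thetaLayerLambdaCongruenceAtTwo_of_ipBz` needs only Bz. CONDITIONAL on the displayed hypothesis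
(item 27798); Kan⁺ is NOT settled and BSD is not proved by this. [cite: Buzzard2000LevelLoweringModTwo, Prop. 2.4]
[cite: Pollack2003, Prop. 6.18 (shape)] [cite: DarmonDiamondTaylor1995, §1.6 Lemma 1.38 and §4.5] -/
theorem thetaLayerLambdaCongruenceAtTwo_of_bz (hBz : buzzard2000_multiplicityOne_gamma0) : ThetaLayerLambdaCongruenceAtTwo :=
  thetaLayerLambdaCongruenceAtTwo_of_ipBz ip_of_crossingPairing_flagSides hBz

/-- The same from the route's single-fact alias ITEM 27798 `BuzzardMultiplicityOneGammaZeroInput` (by name). CONDITIONAL; BSD is not proved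
by this. [cite: Buzzard2000LevelLoweringModTwo, Prop. 2.4] -/
theorem thetaLayerLambdaCongruenceAtTwo_of_buzzardInput (h27798 : BuzzardMultiplicityOneGammaZeroInput) : ThetaLayerLambdaCongruenceAtTwo :=
  thetaLayerLambdaCongruenceAtTwo_of_bz h27798

end Summit.BirchSwinnertonDyer.BirchSwinnertonDyer.Theorems.ThetaLayerLambdaCongruenceAtTwo

end
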